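import Summits.CriticalPhenomena.PercolationContinuityZ3.Theorems.PercNearOneGluingNoHeavyLowerTailAntitheticTwinTop
import HarnessLib

/-!
# `NoHeavyLowerTail` (stmt-CriticalPhenomena-4575) — antithetic cluster pairs: **THE TOP EVENT AT A TWIN WITH CONNECTED COMMON
# NEIGHBOURHOOD — THEOREM TC** (prim-hp-2 gen 73, HOME/THEOREM-TW.md §3)

Support file (`--supports stmt-CriticalPhenomena-4575`, hull-port prover `prim-hp-2`, gen 73).  No definitions, no named facts, no sorries;
standard axioms.  Notation of …AntitheticTwinTop: colourings `T ⊆ Sym2 V`, edge set `E`, source `s`, `X T = openCluster (T ∩ E) s`,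
`Y T = openCluster (Tᶜ ∩ E) s`; `K`-form = super-odd twisted-monotone kernels.  `s ≠ P` are TWINS: `N(s) ∖ {P} = N(P) ∖ {s}` (`htwin`),
`sP ∉ E`; `N` = the common neighbourhood.  On the top event `{P ∈ X T, P ∉ Y T}` every common neighbour `v` has type RR, RB or BR (colours
of `sv`, `Pv`).  …AntitheticTwinTop proved: the part with a red–red neighbour is nonnegative for EVERY twin pair
(`Antithetic.Twin.top_rr_sum_nonneg`).

THIS FILE: the complementary part (no red–red neighbour; types `J` = BR, `K` = RB, both nonempty).  KEY REMARK: on the top event an `E`-pair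
between `j ∈ J` and `k ∈ K` is necessarily RED (`s–j–k–P` would be a blue path).  Fixing the pairs at `s`, at `P` and between `J` and `K`
gives RED-DOMINATED BOXES as soon as one `J–K` pair of `E` is red (`Antithetic.Twin.dom_of_cross`: `P ∈ X T` through `s–k–j–P`; a blue path
of the antipode starts `s–j` with `j ∈ X T` through `P`), so `Antithetic.Box.freeze_boxes_sum_nonneg` (`L = {P}`) gives
* `Antithetic.Twin.top_cross_sum_nonneg` — for EVERY twin pair: `0 ≤ Σ_{T : top event, no red–red neighbour, some red E-pair J–K} K₁K₂`.
If the common neighbourhood induces a CONNECTED subgraph (`hconn`: every bipartition of `N` is crossed by a pair of `E`), every colouring of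
the top event without red–red neighbour has such a red pair, hence
* `Antithetic.Twin.top_sum_nonneg_of_connected` (`K`-form), `Antithetic.Twin.vertex_sum_nonneg_of_connected` — **THEOREM TC**: for twins
  `s, P` whose common neighbourhood induces a connected graph — THE REST OF THE GRAPH BEING ARBITRARY — TOP(E; P) holds in `K`-form and
  the |R| = 1 VERTEX ANTITHETIC INEQUALITY holds at `P`: `0 ≤ Σ_{T : ¬(P ∈ X T ∧ P ∈ Y T)} (F(X T) − F(Y T))·(G(X T) − G(Y T))` for all
  monotone `F, G`.  Examples: `s, P` the two non-adjacent vertices of a `K₄ − e` glued into any graph; `s, P` adjacent to both ends of an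
  edge, to a triangle, to any connected set `N`, with anything attached to `N` and beyond.
[cite: VandenbergHaggstromKahn2005, §1 p. 6 ("Harris' inequality"), §1 p. 3 (open cluster `C_s`)]
-/

noncomputable section

namespace Summit.CriticalPhenomena.PercolationContinuityZ3.Theorems

open Literature.Probability.Percolation
open scoped Classical

namespace Antithetic

namespace Twin

variable {V : Type*}

section Clusters

variable {E : Set (Sym2 V)} {s P : V}

/-- On the top event at a twin, an `E`-pair between a blue–red neighbour `j` (`sj` blue) and a red–blue neighbour `k` (`Pk` blue) is red.
[this work] -/
theorem cross_red_of_top (htwin : ∀ v, v ≠ s → v ≠ P → (s(s, v) ∈ E ↔ s(P, v) ∈ E)) {T : Set (Sym2 V)}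
    (hPY : P ∉ openCluster (Tᶜ ∩ E) s) {j k : V} (hjs : j ≠ s) (hks : k ≠ s) (hkP : k ≠ P)
    (hjE : s(s, j) ∈ E) (hkE : s(s, k) ∈ E) (hsj : s(s, j) ∉ T) (hPk : s(P, k) ∉ T) (hjkE : s(j, k) ∈ E) (hjk : j ≠ k) :
    s(j, k) ∈ T := by
  by_contra h
  have hj : j ∈ openCluster (Tᶜ ∩ E) s := mem_blue_of_pair (mem_openCluster_self _ s) hsj hjE hjs.symm
  have hk : k ∈ openCluster (Tᶜ ∩ E) s := mem_blue_of_pair hj h hjkE hjk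
  have hPkE : s(P, k) ∈ E := (htwin k hks hkP).1 hkE
  exact hPY (mem_blue_of_pair hk (by rw [Sym2.eq_swap]; exact hPk) (by rw [Sym2.eq_swap]; exact hPkE) hkP)

/-- **Red domination of the cross boxes.**  Twins `s, P`, `sP ∉ E`; `T, T'` agree on the pairs at `s`, at `P`, and on the pairs `jk` with
`sj ∉ T`, `sk ∈ T` (`j, k` common neighbours), and are opposite elsewhere; in `T` no common neighbour is blue–blue or red–red, and some
`E`-pair `j₀k₀` with `sj₀ ∉ T`, `sk₀ ∈ T` is red.  Then `Y T' ⊆ X T`. [this work] -/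
theorem dom_of_cross (htwin : ∀ v, v ≠ s → v ≠ P → (s(s, v) ∈ E ↔ s(P, v) ∈ E))
    {T T' : Set (Sym2 V)}
    (hagree : ∀ e : Sym2 V, (s ∈ e ∨ P ∈ e) → (e ∈ T' ↔ e ∈ T))
    (hflip : ∀ e : Sym2 V, ¬ (s ∈ e ∨ P ∈ e) →
      (¬ ∃ j k, e = s(j, k) ∧ j ≠ s ∧ j ≠ P ∧ s(s, j) ∈ E ∧ k ≠ s ∧ k ≠ P ∧ s(s, k) ∈ E ∧ s(s, j) ∉ T ∧ s(s, k) ∈ T) → (e ∈ T' ↔ e ∉ T))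
    (htype : ∀ v, v ≠ s → v ≠ P → s(s, v) ∈ E → (s(s, v) ∈ T ↔ s(P, v) ∉ T))
    {j₀ k₀ : V} (hj₀s : j₀ ≠ s) (hj₀P : j₀ ≠ P) (hj₀E : s(s, j₀) ∈ E) (hk₀s : k₀ ≠ s) (hk₀P : k₀ ≠ P) (hk₀E : s(s, k₀) ∈ E)
    (hsj₀ : s(s, j₀) ∉ T) (hsk₀ : s(s, k₀) ∈ T) (hj₀k₀E : s(j₀, k₀) ∈ E) (hj₀k₀ : s(j₀, k₀) ∈ T) :
    openCluster (T'ᶜ ∩ E) s ⊆ openCluster (T ∩ E) s := by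
  -- `P ∈ X T` through `s – k₀ – j₀ – P`
  have hjk₀ : j₀ ≠ k₀ := fun h => hsj₀ (h ▸ hsk₀)
  have hk₀X : k₀ ∈ openCluster (T ∩ E) s := mem_red_of_pair (mem_openCluster_self _ s) hsk₀ hk₀E hk₀s.symm
  have hj₀X : j₀ ∈ openCluster (T ∩ E) s :=
    mem_red_of_pair hk₀X (by rw [Sym2.eq_swap]; exact hj₀k₀) (by rw [Sym2.eq_swap]; exact hj₀k₀E) hjk₀.symm
  have hPj₀ : s(P, j₀) ∈ T := by
    by_contra h
    exact hsj₀ ((htype j₀ hj₀s hj₀P hj₀E).2 h)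
  have hPX : P ∈ openCluster (T ∩ E) s :=
    mem_red_of_pair hj₀X (by rw [Sym2.eq_swap]; exact hPj₀) (by rw [Sym2.eq_swap]; exact (htwin j₀ hj₀s hj₀P).1 hj₀E) hj₀P
  -- every common neighbour lies in `X T`
  have hN : ∀ v, v ≠ s → v ≠ P → s(s, v) ∈ E → v ∈ openCluster (T ∩ E) s := by
    intro v hvs hvP hvE
    by_cases hsv : s(s, v) ∈ T
    · exact mem_red_of_pair (mem_openCluster_self _ s) hsv hvE hvs.symm
    · have hPv : s(P, v) ∈ T := by
        by_contra h
        exact hsv ((htype v hvs hvP hvE).2 h)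
      exact mem_red_of_pair hPX hPv ((htwin v hvs hvP).1 hvE) hvP.symm
  refine TwoStage.Fan.cluster_subset_of_closed (mem_openCluster_self _ s) fun u w hu huw => ?_
  obtain ⟨⟨hT', hE⟩, hne⟩ := (openGraph_adj _ u w).1 huw
  by_cases hws : w = s
  · rw [hws]; exact mem_openCluster_self _ s
  by_cases hwP : w = P
  · rw [hwP]; exact hPX
  by_cases hA : s ∈ s(u, w) ∨ P ∈ s(u, w)
  · -- a pair at `s` or at `P`: then `w` is a common neighbour
    rcases hA with hA | hA
    · have hus : u = s := by
        rcases Sym2.mem_iff.1 hA with h | h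
        · exact h.symm
        · exact absurd h.symm hws
      subst hus
      exact hN w hws hwP hE
    · have huP : u = P := by
        rcases Sym2.mem_iff.1 hA with h | h
        · exact h.symm
        · exact absurd h.symm hwP
      subst huP
      exact hN w hws hwP ((htwin w hws hwP).2 hE)
  · by_cases hcross : ∃ j k, s(u, w) = s(j, k) ∧ j ≠ s ∧ j ≠ P ∧ s(s, j) ∈ E ∧ k ≠ s ∧ k ≠ P ∧ s(s, k) ∈ E ∧
        s(s, j) ∉ T ∧ s(s, k) ∈ T
    · -- a fixed cross pair: both ends are common neighbours
      obtain ⟨j, k, hejk, hjs, hjP, hjE, hks, hkP, hkE, -, -⟩ := hcross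
      rcases Sym2.eq_iff.1 hejk with ⟨-, hw⟩ | ⟨-, hw⟩
      · rw [hw]; exact hN k hks hkP hkE
      · rw [hw]; exact hN j hjs hjP hjE
    · -- a free pair: blue in `T'` means red in `T`
      have hTr : s(u, w) ∈ T := by
        by_contra h
        exact hT' ((hflip _ hA hcross).2 h)
      exact mem_red_of_pair hu hTr hE hne

end Clusters

variable [Fintype V]

/-- **The cross part of the top event at a twin is nonnegative (every twin pair, `K`-form).**  `s ≠ P` twins, `sP ∉ E`.  Then for all
super-odd twisted-monotone `K₁, K₂`:
`0 ≤ Σ_{T : P ∈ X T, P ∉ Y T, no common neighbour red–red, some E-pair jk red with sj blue and sk red} K₁(X T, Y T)·K₂(X T, Y T)`.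
[this work] -/
theorem top_cross_sum_nonneg (E : Set (Sym2 V)) (s P : V)
    (htwin : ∀ v, v ≠ s → v ≠ P → (s(s, v) ∈ E ↔ s(P, v) ∈ E))
    {K₁ K₂ : Set V → Set V → ℝ}
    (hK₁ : ∀ ⦃A A' B B' : Set V⦄, A ⊆ A' → B' ⊆ B → K₁ A B ≤ K₁ A' B') (hso₁ : ∀ A B, 0 ≤ K₁ A B + K₁ B A)
    (hK₂ : ∀ ⦃A A' B B' : Set V⦄, A ⊆ A' → B' ⊆ B → K₂ A B ≤ K₂ A' B') (hso₂ : ∀ A B, 0 ≤ K₂ A B + K₂ B A) :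
    0 ≤ ∑ T ∈ Finset.univ.filter (fun T : Set (Sym2 V) => P ∈ openCluster (T ∩ E) s ∧ P ∉ openCluster (Tᶜ ∩ E) s ∧
        (∀ v, v ≠ s → v ≠ P → s(s, v) ∈ E → ¬ (s(s, v) ∈ T ∧ s(P, v) ∈ T)) ∧
        ∃ j k, j ≠ s ∧ j ≠ P ∧ s(s, j) ∈ E ∧ k ≠ s ∧ k ≠ P ∧ s(s, k) ∈ E ∧ s(s, j) ∉ T ∧ s(s, k) ∈ T ∧ s(j, k) ∈ E ∧ s(j, k) ∈ T),
      K₁ (openCluster (T ∩ E) s) (openCluster (Tᶜ ∩ E) s) * K₂ (openCluster (T ∩ E) s) (openCluster (Tᶜ ∩ E) s) := by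
  -- common neighbours, the fixed pairs of a colouring (pairs at `s`, at `P`, and the `J–K` pairs), and the "good" patterns
  let nbr : V → Prop := fun v => v ≠ s ∧ v ≠ P ∧ s(s, v) ∈ E
  let cross : Set (Sym2 V) → Set (Sym2 V) := fun N =>
    {e | ∃ j k, e = s(j, k) ∧ nbr j ∧ nbr k ∧ s(s, j) ∉ N ∧ s(s, k) ∈ N}
  let Fix : Set (Sym2 V) → Set (Sym2 V) := fun N => {e | s ∈ e ∨ P ∈ e} ∪ cross N
  let good : Set (Sym2 V) → Prop := fun N =>
    (∀ v, nbr v → (s(s, v) ∈ N ↔ s(P, v) ∉ N)) ∧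
    (∃ j k, nbr j ∧ nbr k ∧ s(s, j) ∉ N ∧ s(s, k) ∈ N ∧ s(j, k) ∈ E ∧ s(j, k) ∈ N)
  have hsA : ∀ N v, s(s, v) ∈ Fix N := fun N v => Or.inl (Or.inl (Sym2.mem_mk_left s v))
  have hPA : ∀ N v, s(P, v) ∈ Fix N := fun N v => Or.inl (Or.inr (Sym2.mem_mk_left P v))
  -- `Fix` only depends on the pairs at `s`
  have hcross_eq : ∀ N M : Set (Sym2 V), (∀ v, (s(s, v) ∈ M ↔ s(s, v) ∈ N)) → cross N = cross M := by
    intro N M h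
    ext e
    simp only [cross, Set.mem_setOf_eq]
    constructor
    · rintro ⟨j, k, he, hj, hk, h1, h2⟩
      exact ⟨j, k, he, hj, hk, fun h' => h1 ((h j).1 h'), (h k).2 h2⟩
    · rintro ⟨j, k, he, hj, hk, h1, h2⟩
      exact ⟨j, k, he, hj, hk, fun h' => h1 ((h j).2 h'), (h k).1 h2⟩
  have hFix_eq : ∀ N M : Set (Sym2 V), (∀ v, (s(s, v) ∈ M ↔ s(s, v) ∈ N)) → Fix N = Fix M := by
    intro N M h
    show {e | s ∈ e ∨ P ∈ e} ∪ cross N = {e | s ∈ e ∨ P ∈ e} ∪ cross M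
    rw [hcross_eq N M h]
  -- `good` only depends on the pairs of `Fix`
  have hgood_of : ∀ N M : Set (Sym2 V), (∀ e ∈ Fix N, (e ∈ M ↔ e ∈ N)) → good N → good M := by
    rintro N M h ⟨htype, j, k, hj, hk, h1, h2, h3, h4⟩
    refine ⟨fun v hv => ?_, j, k, hj, hk, fun h' => h1 ((h _ (hsA N j)).1 h'), (h _ (hsA N k)).2 h2, h3, ?_⟩
    · rw [h _ (hsA N v), h _ (hPA N v)]
      exact htype v hv
    · have hjk : s(j, k) ∈ Fix N := Or.inr ⟨j, k, rfl, hj, hk, h1, h2⟩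
      exact (h _ hjk).2 h4
  let C := {N : Set (Sym2 V) // N ⊆ Fix N ∧ good N}
  let D : Finset (Set (Sym2 V)) := Finset.univ.filter fun T => good T
  have hfreeze := Box.freeze_boxes_sum_nonneg E s D (fun c : C => Fix c.1) (fun c : C => c.1)
    (fun T hT => ?_) (fun c T hT => ?_) (fun c c' T hc hc' => ?_) (fun c T T' hT hT' hflip => ?_) {P} hK₁ hso₁ hK₂ hso₂
  · -- identify the frozen event with the cross top event
    have hev : D.filter (fun T => ∀ Q ∈ ({P} : Set V), Q ∉ openCluster (Tᶜ ∩ E) s) =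
        Finset.univ.filter (fun T : Set (Sym2 V) => P ∈ openCluster (T ∩ E) s ∧ P ∉ openCluster (Tᶜ ∩ E) s ∧
          (∀ v, v ≠ s → v ≠ P → s(s, v) ∈ E → ¬ (s(s, v) ∈ T ∧ s(P, v) ∈ T)) ∧
          ∃ j k, j ≠ s ∧ j ≠ P ∧ s(s, j) ∈ E ∧ k ≠ s ∧ k ≠ P ∧ s(s, k) ∈ E ∧ s(s, j) ∉ T ∧ s(s, k) ∈ T ∧
            s(j, k) ∈ E ∧ s(j, k) ∈ T) := by
      ext T
      simp only [D, Finset.mem_filter, Finset.mem_univ, true_and, Set.mem_singleton_iff, forall_eq]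
      constructor
      · rintro ⟨⟨htype, j, k, hj, hk, h1, h2, h3, h4⟩, hPY⟩
        have hjk : j ≠ k := fun h => h1 (h ▸ h2)
        have hkX : k ∈ openCluster (T ∩ E) s := mem_red_of_pair (mem_openCluster_self _ s) h2 hk.2.2 hk.1.symm
        have hjX : j ∈ openCluster (T ∩ E) s :=
          mem_red_of_pair hkX (by rw [Sym2.eq_swap]; exact h4) (by rw [Sym2.eq_swap]; exact h3) hjk.symm
        have hPj : s(P, j) ∈ T := by
          by_contra h
          exact h1 ((htype j hj).2 h)
        have hPX : P ∈ openCluster (T ∩ E) s :=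
          mem_red_of_pair hjX (by rw [Sym2.eq_swap]; exact hPj) (by rw [Sym2.eq_swap]; exact (htwin j hj.1 hj.2.1).1 hj.2.2) hj.2.1
        refine ⟨hPX, hPY, fun v hvs hvP hvE h => ?_, j, k, hj.1, hj.2.1, hj.2.2, hk.1, hk.2.1, hk.2.2, h1, h2, h3, h4⟩
        exact ((htype v ⟨hvs, hvP, hvE⟩).1 h.1) h.2
      · rintro ⟨-, hPY, hnoRR, j, k, hjs, hjP, hjE, hks, hkP, hkE, h1, h2, h3, h4⟩
        refine ⟨⟨fun v hv => ⟨fun h h' => hnoRR v hv.1 hv.2.1 hv.2.2 ⟨h, h'⟩, fun h => ?_⟩, j, k, ⟨hjs, hjP, hjE⟩, ⟨hks, hkP, hkE⟩,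
          h1, h2, h3, h4⟩, hPY⟩
        rcases noBB_of_top htwin hPY hv.1 hv.2.1 hv.2.2 with h' | h'
        · exact h'
        · exact absurd h' h
    rw [← hev]
    exact hfreeze
  · -- cover: the box of `T` is indexed by `T ∩ Fix T`
    have hgT : good T := (Finset.mem_filter.1 hT).2
    have hFT : Fix (T ∩ Fix T) = Fix T :=
      (hFix_eq T (T ∩ Fix T) fun v => ⟨fun h => h.1, fun h => ⟨h, hsA T v⟩⟩).symm
    refine ⟨⟨T ∩ Fix T, ?_, ?_⟩, fun e he => ?_⟩
    · rw [hFT]; exact Set.inter_subset_right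
    · exact hgood_of T (T ∩ Fix T) (fun e he => ⟨fun h => h.1, fun h => ⟨h, he⟩⟩) hgT
    · change e ∈ Fix (T ∩ Fix T) at he
      rw [hFT] at he
      exact ⟨fun h => ⟨h, he⟩, fun h => h.1⟩
  · -- inside
    exact Finset.mem_filter.2 ⟨Finset.mem_univ _, hgood_of c.1 T hT c.2.2⟩
  · -- uniqueness: both indices are `T ∩ Fix T`
    have hF : ∀ d : C, (∀ e ∈ Fix d.1, (e ∈ T ↔ e ∈ d.1)) → Fix d.1 = Fix T := fun d hd =>
      hFix_eq d.1 T fun v => hd _ (hsA d.1 v)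
    have hval : ∀ d : C, (∀ e ∈ Fix d.1, (e ∈ T ↔ e ∈ d.1)) → d.1 = T ∩ Fix T := by
      intro d hd
      ext e
      constructor
      · intro he
        have heF : e ∈ Fix d.1 := d.2.1 he
        exact ⟨(hd e heF).2 he, (hF d hd) ▸ heF⟩
      · rintro ⟨heT, heF⟩
        rw [← hF d hd] at heF
        exact (hd e heF).1 heT
    exact Subtype.ext ((hval c hc).trans (hval c' hc').symm)
  · -- red domination of the cross box
    have hgT : good T := hgood_of c.1 T hT c.2.2
    obtain ⟨htype, j₀, k₀, hj₀, hk₀, h1, h2, h3, h4⟩ := hgT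
    have hFc : Fix c.1 = Fix T := hFix_eq c.1 T fun v => hT _ (hsA c.1 v)
    refine dom_of_cross htwin (fun e he => ?_) (fun e he hne => ?_)
      (fun v hvs hvP hvE => htype v ⟨hvs, hvP, hvE⟩) hj₀.1 hj₀.2.1 hj₀.2.2 hk₀.1 hk₀.2.1 hk₀.2.2 h1 h2 h3 h4
    · have heF : e ∈ Fix c.1 := Or.inl he
      exact (hT' e heF).trans (hT e heF).symm
    · refine hflip e fun heF => ?_
      rw [hFc] at heF
      rcases heF with heF | ⟨j, k, hejk, hj, hk, hsj, hsk⟩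
      · exact he heF
      · exact hne ⟨j, k, hejk, hj.1, hj.2.1, hj.2.2, hk.1, hk.2.1, hk.2.2, hsj, hsk⟩

/-- **THEOREM TC (top form, `K`-form).**  Twins `s ≠ P`, `sP ∉ E`, whose common neighbourhood induces a CONNECTED graph (`hconn`: every
set `S` of vertices containing a common neighbour and missing another one is crossed by a pair of `E` between two common neighbours) — the
rest of the graph arbitrary.  Then `0 ≤ Σ_{T : P ∈ X T, P ∉ Y T} K₁(X T, Y T)·K₂(X T, Y T)` for all super-odd twisted-monotone `K₁, K₂`.
[this work] -/
theorem top_sum_nonneg_of_connected (E : Set (Sym2 V)) (s P : V) (hsP : s ≠ P) (hsPE : s(s, P) ∉ E)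
    (htwin : ∀ v, v ≠ s → v ≠ P → (s(s, v) ∈ E ↔ s(P, v) ∈ E))
    (hconn : ∀ S : Set V, (∃ j ∈ S, j ≠ s ∧ j ≠ P ∧ s(s, j) ∈ E) → (∃ k ∉ S, k ≠ s ∧ k ≠ P ∧ s(s, k) ∈ E) →
      ∃ j ∈ S, ∃ k ∉ S, j ≠ s ∧ j ≠ P ∧ s(s, j) ∈ E ∧ k ≠ s ∧ k ≠ P ∧ s(s, k) ∈ E ∧ s(j, k) ∈ E)
    {K₁ K₂ : Set V → Set V → ℝ}
    (hK₁ : ∀ ⦃A A' B B' : Set V⦄, A ⊆ A' → B' ⊆ B → K₁ A B ≤ K₁ A' B') (hso₁ : ∀ A B, 0 ≤ K₁ A B + K₁ B A)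
    (hK₂ : ∀ ⦃A A' B B' : Set V⦄, A ⊆ A' → B' ⊆ B → K₂ A B ≤ K₂ A' B') (hso₂ : ∀ A B, 0 ≤ K₂ A B + K₂ B A) :
    0 ≤ ∑ T ∈ Finset.univ.filter (fun T : Set (Sym2 V) => P ∈ openCluster (T ∩ E) s ∧ P ∉ openCluster (Tᶜ ∩ E) s),
      K₁ (openCluster (T ∩ E) s) (openCluster (Tᶜ ∩ E) s) * K₂ (openCluster (T ∩ E) s) (openCluster (Tᶜ ∩ E) s) := by
  -- the top event is the disjoint union of the red–red part and the cross part
  have hrr := top_rr_sum_nonneg E s P htwin hK₁ hso₁ hK₂ hso₂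
  have hcr := top_cross_sum_nonneg E s P htwin hK₁ hso₁ hK₂ hso₂
  have hdisj : Disjoint
      (Finset.univ.filter (fun T : Set (Sym2 V) => P ∈ openCluster (T ∩ E) s ∧ P ∉ openCluster (Tᶜ ∩ E) s ∧
        ∃ v, v ≠ s ∧ v ≠ P ∧ s(s, v) ∈ E ∧ s(s, v) ∈ T ∧ s(P, v) ∈ T))
      (Finset.univ.filter (fun T : Set (Sym2 V) => P ∈ openCluster (T ∩ E) s ∧ P ∉ openCluster (Tᶜ ∩ E) s ∧
        (∀ v, v ≠ s → v ≠ P → s(s, v) ∈ E → ¬ (s(s, v) ∈ T ∧ s(P, v) ∈ T)) ∧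
        ∃ j k, j ≠ s ∧ j ≠ P ∧ s(s, j) ∈ E ∧ k ≠ s ∧ k ≠ P ∧ s(s, k) ∈ E ∧ s(s, j) ∉ T ∧ s(s, k) ∈ T ∧
          s(j, k) ∈ E ∧ s(j, k) ∈ T)) := by
    rw [Finset.disjoint_filter]
    rintro T - ⟨-, -, v, hvs, hvP, hvE, h1, h2⟩ ⟨-, -, hno, -⟩
    exact hno v hvs hvP hvE ⟨h1, h2⟩
  have hunion :
      Finset.univ.filter (fun T : Set (Sym2 V) => P ∈ openCluster (T ∩ E) s ∧ P ∉ openCluster (Tᶜ ∩ E) s ∧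
        ∃ v, v ≠ s ∧ v ≠ P ∧ s(s, v) ∈ E ∧ s(s, v) ∈ T ∧ s(P, v) ∈ T) ∪
      Finset.univ.filter (fun T : Set (Sym2 V) => P ∈ openCluster (T ∩ E) s ∧ P ∉ openCluster (Tᶜ ∩ E) s ∧
        (∀ v, v ≠ s → v ≠ P → s(s, v) ∈ E → ¬ (s(s, v) ∈ T ∧ s(P, v) ∈ T)) ∧
        ∃ j k, j ≠ s ∧ j ≠ P ∧ s(s, j) ∈ E ∧ k ≠ s ∧ k ≠ P ∧ s(s, k) ∈ E ∧ s(s, j) ∉ T ∧ s(s, k) ∈ T ∧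
          s(j, k) ∈ E ∧ s(j, k) ∈ T) =
      Finset.univ.filter (fun T : Set (Sym2 V) => P ∈ openCluster (T ∩ E) s ∧ P ∉ openCluster (Tᶜ ∩ E) s) := by
    rw [← Finset.filter_or]
    refine Finset.filter_congr fun T _ => ⟨?_, fun h => ?_⟩
    · rintro (h | h)
      · exact ⟨h.1, h.2.1⟩
      · exact ⟨h.1, h.2.1⟩
    · obtain ⟨hPX, hPY⟩ := h
      by_cases hRR : ∃ v, v ≠ s ∧ v ≠ P ∧ s(s, v) ∈ E ∧ s(s, v) ∈ T ∧ s(P, v) ∈ T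
      · exact Or.inl ⟨hPX, hPY, hRR⟩
      · right
        have hnoRR : ∀ v, v ≠ s → v ≠ P → s(s, v) ∈ E → ¬ (s(s, v) ∈ T ∧ s(P, v) ∈ T) :=
          fun v hvs hvP hvE h' => hRR ⟨v, hvs, hvP, hvE, h'.1, h'.2⟩
        refine ⟨hPX, hPY, hnoRR, ?_⟩
        -- `J` (blue-`s` common neighbours) is nonempty: else every `Pv` is blue and `P ∉ X T`
        have hJ : ∃ j ∈ {v | s(s, v) ∉ T}, j ≠ s ∧ j ≠ P ∧ s(s, j) ∈ E := by
          by_contra hJ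
          have hPb : ∀ v, v ≠ s → v ≠ P → s(s, v) ∈ E → s(P, v) ∉ T := by
            intro v hvs hvP hvE hPv
            have hsv : s(s, v) ∈ T := by
              by_contra h
              exact hJ ⟨v, h, hvs, hvP, hvE⟩
            exact hnoRR v hvs hvP hvE ⟨hsv, hPv⟩
          have hXP : openCluster (T ∩ E) s ⊆ {u | u ≠ P} := by
            refine TwoStage.Fan.cluster_subset_of_closed (show s ∈ {u : V | u ≠ P} from hsP) fun u w hu huw => ?_
            obtain ⟨⟨hTr, hE'⟩, hne⟩ := (openGraph_adj _ u w).1 huw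
            intro hwP
            rw [hwP] at hTr hE' hne
            have hus : u ≠ s := by
              rintro rfl
              exact hsPE hE'
            have huE : s(s, u) ∈ E := (htwin u hus hne).2 (by rw [Sym2.eq_swap]; exact hE')
            exact hPb u hus hne huE (by rw [Sym2.eq_swap]; exact hTr)
          exact (hXP hPX) rfl
        -- `K` (red-`s` common neighbours) is nonempty: else the red cluster of `s` is `{s}`
        have hK : ∃ k ∉ {v | s(s, v) ∉ T}, k ≠ s ∧ k ≠ P ∧ s(s, k) ∈ E := by
          by_contra hK
          have hXs : openCluster (T ∩ E) s ⊆ {s} := by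
            refine TwoStage.Fan.cluster_subset_of_closed (Set.mem_singleton s) fun u w hu huw => ?_
            obtain ⟨⟨hTr, hE'⟩, hne⟩ := (openGraph_adj _ u w).1 huw
            rw [Set.mem_singleton_iff] at hu
            subst hu
            exfalso
            by_cases hwP : w = P
            · exact hsPE (hwP ▸ hE')
            · exact hK ⟨w, fun h => h hTr, Ne.symm hne, hwP, hE'⟩
          exact hsP (Set.mem_singleton_iff.1 (hXs hPX)).symm
        obtain ⟨j, hj, k, hk, hjs, hjP, hjE, hks, hkP, hkE, hjkE⟩ := hconn {v | s(s, v) ∉ T} hJ hK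
        have hsj : s(s, j) ∉ T := hj
        have hsk : s(s, k) ∈ T := by
          by_contra h'
          exact hk h'
        have hPk : s(P, k) ∉ T := fun h' => hnoRR k hks hkP hkE ⟨hsk, h'⟩
        have hjk : j ≠ k := fun h' => hsj (h' ▸ hsk)
        exact ⟨j, k, hjs, hjP, hjE, hks, hkP, hkE, hsj, hsk, hjkE, cross_red_of_top htwin hPY hjs hks hkP hjE hkE hsj hPk hjkE hjk⟩
  rw [← hunion, Finset.sum_union hdisj]
  exact add_nonneg hrr hcr

/-- **THEOREM TC (the |R| = 1 vertex antithetic inequality at a twin with connected common neighbourhood).**  Let `s ≠ P` be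
non-adjacent twins whose common neighbourhood induces a connected subgraph (`hconn`); the rest of the graph is arbitrary.  Then for all
monotone `F, G`:  `0 ≤ Σ_{T : ¬(P ∈ X T ∧ P ∈ Y T)} (F(X T) − F(Y T))·(G(X T) − G(Y T))`. [this work] -/
theorem vertex_sum_nonneg_of_connected (E : Set (Sym2 V)) (s P : V) (hsP : s ≠ P) (hsPE : s(s, P) ∉ E)
    (htwin : ∀ v, v ≠ s → v ≠ P → (s(s, v) ∈ E ↔ s(P, v) ∈ E))
    (hconn : ∀ S : Set V, (∃ j ∈ S, j ≠ s ∧ j ≠ P ∧ s(s, j) ∈ E) → (∃ k ∉ S, k ≠ s ∧ k ≠ P ∧ s(s, k) ∈ E) →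
      ∃ j ∈ S, ∃ k ∉ S, j ≠ s ∧ j ≠ P ∧ s(s, j) ∈ E ∧ k ≠ s ∧ k ≠ P ∧ s(s, k) ∈ E ∧ s(j, k) ∈ E)
    {F G : Set V → ℝ} (hF : Monotone F) (hG : Monotone G) :
    0 ≤ ∑ T ∈ Finset.univ.filter (fun T : Set (Sym2 V) =>
        ¬ ((openGraph (T ∩ E)).Reachable s P ∧ (openGraph (Tᶜ ∩ E)).Reachable s P)),
      (F (openCluster (T ∩ E) s) - F (openCluster (Tᶜ ∩ E) s)) * (G (openCluster (T ∩ E) s) - G (openCluster (Tᶜ ∩ E) s)) := by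
  refine TopVertex.vertex_sum_nonneg_of_top E s P (fun F' G' hF' hG' => ?_) hF hG
  have hK₁ : ∀ ⦃A A' B B' : Set V⦄, A ⊆ A' → B' ⊆ B → F' A - F' B ≤ F' A' - F' B' :=
    fun A A' B B' hA hB => sub_le_sub (hF' hA) (hF' hB)
  have hK₂ : ∀ ⦃A A' B B' : Set V⦄, A ⊆ A' → B' ⊆ B → G' A - G' B ≤ G' A' - G' B' :=
    fun A A' B B' hA hB => sub_le_sub (hG' hA) (hG' hB)
  have hso₁ : ∀ A B : Set V, 0 ≤ (F' A - F' B) + (F' B - F' A) := fun A B => by linarith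
  have hso₂ : ∀ A B : Set V, 0 ≤ (G' A - G' B) + (G' B - G' A) := fun A B => by linarith
  exact top_sum_nonneg_of_connected E s P hsP hsPE htwin hconn (K₁ := fun A B => F' A - F' B) (K₂ := fun A B => G' A - G' B)
    hK₁ hso₁ hK₂ hso₂

end Twin

end Antithetic

end Summit.CriticalPhenomena.PercolationContinuityZ3.Theorems
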